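import Summits.KontsevichZagierPeriods.KontsevichZagierPeriods.Theorems.HurwitzMicroSectorsNormalFormPrincipleM2FiveZetaTwo

/-!
# `NormalFormPrinciple` (stmt-KontsevichZagierPeriods-3869), line `SketchIdeator1` — leaf `stub_boxRigidity`,
# dimension two off the product type (`CatalanTwoWays`, disc side): the Möbius kit

With `t₈ = √2 − 1 = tan(π/8)` (so `t₈² + 2t₈ − 1 = 0`) and the Möbius factors
`c₁(s) = (1 − s t₈)/(s + t₈) = cot(arctan s + π/8)`, `c₂(s) = (1 + t₈ s)/(t₈ − s) = cot(π/8 − arctan s)`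
of the half-angle base change `x = 2√2 s/(1+s²)` on the disc side of `CatalanTwoWays`, we prove:
`(1/(1+s²)) log c₁(s)` and `(1/(1+s²)) log c₂(s)` are absolutely integrable on `(0, t₈)` (the
first is measurable and bounded, the second is dominated by `1 + |log (t₈ − s)|`, integrable
because `log` is integrable at `0`); `c₁, c₂ ≥ 1` on `(0, t₈)`; `√(2 − x²) = √2 (1−s²)/(1+s²)`
for `s ∈ [0,1)`; and the factorisation `(a+1)/(a−1) = c₁(s) c₂(s)` with `a = √2 (1−s²)/(1+s²)`
on `(0, t₈)`. Pure Mathlib real analysis and algebra (polynomial identities in `s` and `√2`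
modulo `(√2)² = 2`); no new definitions.
References: M. Kontsevich, D. Zagier, *Periods* (2001), §1.2.
-/

noncomputable section

open MeasureTheory Set
open Literature.NumberTheory.Transcendental Literature.NumberTheory.Transcendental.KZ
open Literature.ModelTheory.ExponentialFields (IsSemialgebraic)

namespace Summit.KontsevichZagierPeriods.HurwitzMicroSectors.NormalFormPrinciple.PiBox.M2

/-- Basic facts about `√2`: `(√2)² = 2` and `7/5 < √2 < 3/2`. -/
private theorem sqrt_two_facts :
    Real.sqrt 2 ^ 2 = 2 ∧ 7 / 5 < Real.sqrt 2 ∧ Real.sqrt 2 < 3 / 2 := by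
  refine ⟨Real.sq_sqrt (by norm_num), ?_, ?_⟩
  · rw [Real.lt_sqrt (by norm_num)]
    norm_num
  · rw [Real.sqrt_lt' (by norm_num)]
    norm_num

/-- The Möbius factors `c₁(s) = (1 − s t₈)/(s + t₈)` and `c₂(s) = (1 + t₈ s)/(t₈ − s)` are at
least `1` on `(0, t₈)`, `t₈ = √2 − 1` (for `c₁` this is `s (1 + t₈) < t₈ (1 + t₈) = 1 − t₈`). -/
private theorem one_le_moebius {s : ℝ} (hs : s ∈ Ioo (0:ℝ) (Real.sqrt 2 - 1)) :
    1 ≤ (1 - s * (Real.sqrt 2 - 1)) / (s + (Real.sqrt 2 - 1)) ∧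
      1 ≤ (1 + (Real.sqrt 2 - 1) * s) / ((Real.sqrt 2 - 1) - s) := by
  obtain ⟨hr2, hr1, hr3⟩ := sqrt_two_facts
  set r := Real.sqrt 2
  obtain ⟨hs0, hst⟩ := hs
  have hr0 : (0:ℝ) < r := by linarith
  constructor
  · rw [le_div_iff₀ (by linarith)]
    nlinarith [mul_pos hr0 (sub_pos.2 hst)]
  · rw [le_div_iff₀ (sub_pos.2 hst)]
    nlinarith [mul_pos hr0 hs0]

/-- Pointwise bound for the first Möbius logarithm: on `(0, t₈)` one has `1 ≤ c₁(s) ≤ 3`, hence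
`‖(1/(1+s²)) log c₁(s)‖ ≤ log c₁(s) ≤ c₁(s) − 1 ≤ 2`. -/
private theorem norm_log_moebius₁_le {s : ℝ} (hs : s ∈ Ioo (0:ℝ) (Real.sqrt 2 - 1)) :
    ‖(1 / (1 + s ^ 2)) * Real.log ((1 - s * (Real.sqrt 2 - 1)) / (s + (Real.sqrt 2 - 1)))‖ ≤ 2 := by
  have hc := (one_le_moebius hs).1
  obtain ⟨hr2, hr1, hr3⟩ := sqrt_two_facts
  set r := Real.sqrt 2
  obtain ⟨hs0, hst⟩ := hs
  have hr0 : (0:ℝ) < r := by linarith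
  have hpos : (0:ℝ) < 1 / (1 + s ^ 2) := by positivity
  have hle : 1 / (1 + s ^ 2) ≤ 1 := by
    rw [div_le_one (by positivity)]
    nlinarith
  have hc3 : (1 - s * (r - 1)) / (s + (r - 1)) ≤ 3 := by
    rw [div_le_iff₀ (by linarith)]
    nlinarith [mul_pos hr0 hs0]
  have hlog0 : 0 ≤ Real.log ((1 - s * (r - 1)) / (s + (r - 1))) := Real.log_nonneg hc
  have hlog2 : Real.log ((1 - s * (r - 1)) / (s + (r - 1))) ≤ 2 := by
    have := Real.log_le_sub_one_of_pos (by linarith : (0:ℝ) < (1 - s * (r - 1)) / (s + (r - 1)))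
    linarith
  rw [Real.norm_eq_abs, abs_mul, abs_of_pos hpos, abs_of_nonneg hlog0]
  calc 1 / (1 + s ^ 2) * Real.log ((1 - s * (r - 1)) / (s + (r - 1)))
      ≤ 1 * 2 := mul_le_mul hle hlog2 hlog0 zero_le_one
    _ = 2 := one_mul _

/-- Pointwise domination for the second Möbius logarithm: on `(0, t₈)`,
`log c₂(s) = log (1 + t₈ s) − log (t₈ − s)` with `0 ≤ log (1 + t₈ s) ≤ t₈ s ≤ 1`, hence
`‖(1/(1+s²)) log c₂(s)‖ ≤ 1 + |log (t₈ − s)|`. -/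
private theorem norm_log_moebius₂_le {s : ℝ} (hs : s ∈ Ioo (0:ℝ) (Real.sqrt 2 - 1)) :
    ‖(1 / (1 + s ^ 2)) * Real.log ((1 + (Real.sqrt 2 - 1) * s) / ((Real.sqrt 2 - 1) - s))‖ ≤
      1 + |Real.log ((Real.sqrt 2 - 1) - s)| := by
  obtain ⟨-, hr1, hr3⟩ := sqrt_two_facts
  set r := Real.sqrt 2
  obtain ⟨hs0, hst⟩ := hs
  have hpos : (0:ℝ) < 1 / (1 + s ^ 2) := by positivity
  have hle : 1 / (1 + s ^ 2) ≤ 1 := by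
    rw [div_le_one (by positivity)]
    nlinarith
  have hnum : (1:ℝ) ≤ 1 + (r - 1) * s := by nlinarith
  have hlog1 : |Real.log (1 + (r - 1) * s)| ≤ 1 := by
    rw [abs_of_nonneg (Real.log_nonneg hnum)]
    have := Real.log_le_sub_one_of_pos (zero_lt_one.trans_le hnum)
    nlinarith
  rw [Real.norm_eq_abs, abs_mul, abs_of_pos hpos,
    Real.log_div (zero_lt_one.trans_le hnum).ne' (sub_pos.2 hst).ne']
  calc 1 / (1 + s ^ 2) * |Real.log (1 + (r - 1) * s) - Real.log (r - 1 - s)|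
      ≤ 1 * |Real.log (1 + (r - 1) * s) - Real.log (r - 1 - s)| := by gcongr
    _ ≤ |Real.log (1 + (r - 1) * s)| + |Real.log (r - 1 - s)| := by
      rw [one_mul]
      exact abs_sub _ _
    _ ≤ 1 + |Real.log (r - 1 - s)| := by gcongr

/-- `(1/(1+s²)) log c₁(s)` is integrable on `(0, t₈)`: a bounded measurable function on a set of
finite measure. -/
private theorem integrableOn_log_moebius₁ :
    IntegrableOn (fun s : ℝ => (1 / (1 + s ^ 2)) *
      Real.log ((1 - s * (Real.sqrt 2 - 1)) / (s + (Real.sqrt 2 - 1)))) (Ioo (0:ℝ) (Real.sqrt 2 - 1)) := by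
  have hmeas : Measurable fun s : ℝ => (1 / (1 + s ^ 2)) *
      Real.log ((1 - s * (Real.sqrt 2 - 1)) / (s + (Real.sqrt 2 - 1))) := by fun_prop
  exact Measure.integrableOn_of_bounded (M := 2) measure_Ioo_lt_top.ne hmeas.aestronglyMeasurable
    ((ae_restrict_iff' measurableSet_Ioo).2 (ae_of_all _ fun s hs => norm_log_moebius₁_le hs))

/-- `(1/(1+s²)) log c₂(s)` is integrable on `(0, t₈)`: it is measurable and dominated by the
integrable function `1 + |log (t₈ − s)|` (`log` is integrable on every bounded interval). -/
private theorem integrableOn_log_moebius₂ :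
    IntegrableOn (fun s : ℝ => (1 / (1 + s ^ 2)) *
      Real.log ((1 + (Real.sqrt 2 - 1) * s) / ((Real.sqrt 2 - 1) - s))) (Ioo (0:ℝ) (Real.sqrt 2 - 1)) := by
  obtain ⟨-, hr1, -⟩ := sqrt_two_facts
  have ht0 : (0:ℝ) ≤ Real.sqrt 2 - 1 := by linarith
  have hlog : IntegrableOn (fun s : ℝ => Real.log ((Real.sqrt 2 - 1) - s))
      (Ioo (0:ℝ) (Real.sqrt 2 - 1)) := by
    have h := (intervalIntegral.intervalIntegrable_log' (a := Real.sqrt 2 - 1) (b := 0)).comp_sub_left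
      (Real.sqrt 2 - 1)
    rw [sub_self, sub_zero] at h
    exact (intervalIntegrable_iff_integrableOn_Ioo_of_le ht0).1 h
  have hF : IntegrableOn (fun s : ℝ => 1 + |Real.log ((Real.sqrt 2 - 1) - s)|)
      (Ioo (0:ℝ) (Real.sqrt 2 - 1)) :=
    (integrableOn_const measure_Ioo_lt_top.ne).add hlog.abs
  have hmeas : Measurable fun s : ℝ => (1 / (1 + s ^ 2)) *
      Real.log ((1 + (Real.sqrt 2 - 1) * s) / ((Real.sqrt 2 - 1) - s)) := by fun_prop
  refine Integrable.mono' hF hmeas.aestronglyMeasurable ?_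
  exact (ae_restrict_iff' measurableSet_Ioo).2 (ae_of_all _ fun s hs => norm_log_moebius₂_le hs)

/-- The half-angle substitution on the disc side: for `s ∈ [0,1)` and `x = 2√2 s/(1+s²)`,
`√(2 − x²) = √2 (1 − s²)/(1 + s²)` (the radicand is the square of the nonnegative right side). -/
private theorem sqrt_two_sub_halfAngle_sq {s : ℝ} (hs : s ∈ Ico (0:ℝ) 1) :
    Real.sqrt (2 - (2 * Real.sqrt 2 * s / (1 + s ^ 2)) ^ 2) =
      Real.sqrt 2 * (1 - s ^ 2) / (1 + s ^ 2) := by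
  obtain ⟨hr2, hr1, -⟩ := sqrt_two_facts
  set r := Real.sqrt 2
  obtain ⟨hs0, hs1⟩ := hs
  have h1 : (0:ℝ) < 1 + s ^ 2 := by positivity
  have hs2 : s ^ 2 ≤ 1 := by nlinarith
  have key : 2 - (2 * r * s / (1 + s ^ 2)) ^ 2 = (r * (1 - s ^ 2) / (1 + s ^ 2)) ^ 2 := by
    rw [div_pow, div_pow, eq_div_iff (by positivity), sub_mul, div_mul_cancel₀ _ (by positivity)]
    linear_combination (-(4 * s ^ 2) - (1 - s ^ 2) ^ 2) * hr2
  rw [key, Real.sqrt_sq (div_nonneg (mul_nonneg (by linarith) (by linarith)) h1.le)]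

/-- The Möbius factorisation: for `s ∈ (0, t₈)` and `a = √2 (1−s²)/(1+s²)` (so `a > 1`),
`(a + 1)/(a − 1) = c₁(s) c₂(s)` — a polynomial identity in `s` and `√2` modulo `(√2)² = 2`,
all denominators being nonzero on the range. -/
private theorem moebius_factorisation {s : ℝ} (hs : s ∈ Ioo (0:ℝ) (Real.sqrt 2 - 1)) :
    (Real.sqrt 2 * (1 - s ^ 2) / (1 + s ^ 2) + 1) / (Real.sqrt 2 * (1 - s ^ 2) / (1 + s ^ 2) - 1) =
      ((1 - s * (Real.sqrt 2 - 1)) / (s + (Real.sqrt 2 - 1))) *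
        ((1 + (Real.sqrt 2 - 1) * s) / ((Real.sqrt 2 - 1) - s)) := by
  obtain ⟨hr2, hr1, -⟩ := sqrt_two_facts
  set r := Real.sqrt 2
  obtain ⟨hs0, hst⟩ := hs
  have h1 : (1:ℝ) + s ^ 2 ≠ 0 := by positivity
  have hr3' : r ^ 3 = 2 * r := by rw [pow_succ, hr2]
  -- the denominator `√2 (1 − s²) − (1 + s²) = (√2 + 1) ((√2 − 1)² − s²)` is positive for `s < t₈`
  have hD : 0 < r * (1 - s ^ 2) - (1 + s ^ 2) := by
    nlinarith [mul_pos (mul_pos (by linarith : (0:ℝ) < r + 1) (sub_pos.2 hst))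
      (by linarith : (0:ℝ) < r - 1 + s)]
  rw [div_add_one h1, div_sub_one h1, div_div_div_cancel_right₀ h1, div_mul_div_comm,
    div_eq_div_iff hD.ne' (mul_pos (by linarith) (sub_pos.2 hst)).ne']
  linear_combination (1 - s ^ 2) * (1 + s ^ 2) * (r - 1) * hr2

/-- **Möbius kit** for the disc side of `CatalanTwoWays`. With `t₈ = √2 − 1 = tan(π/8)` and the
Möbius factors `c₁(s) = (1 − s t₈)/(s + t₈)`, `c₂(s) = (1 + t₈ s)/(t₈ − s)`: the integrands
`(1/(1+s²)) log c₁(s)` and `(1/(1+s²)) log c₂(s)` are absolutely integrable on `(0, t₈)`;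
`c₁(s), c₂(s) ≥ 1` there; the half-angle substitution `x = 2√2 s/(1+s²)` gives
`√(2 − x²) = √2 (1−s²)/(1+s²)` for `s ∈ [0,1)`; and with `a = √2 (1−s²)/(1+s²)` one has the
factorisation `(a+1)/(a−1) = c₁(s) c₂(s)` on `(0, t₈)`. [cite: KontsevichZagier2001, §1.2] -/
theorem moebius_kit :
    IntegrableOn (fun s : ℝ => (1 / (1 + s ^ 2)) *
      Real.log ((1 - s * (Real.sqrt 2 - 1)) / (s + (Real.sqrt 2 - 1)))) (Set.Ioo (0:ℝ) (Real.sqrt 2 - 1)) ∧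
    IntegrableOn (fun s : ℝ => (1 / (1 + s ^ 2)) *
      Real.log ((1 + (Real.sqrt 2 - 1) * s) / ((Real.sqrt 2 - 1) - s))) (Set.Ioo (0:ℝ) (Real.sqrt 2 - 1)) ∧
    (∀ s ∈ Set.Ioo (0:ℝ) (Real.sqrt 2 - 1),
      1 ≤ (1 - s * (Real.sqrt 2 - 1)) / (s + (Real.sqrt 2 - 1)) ∧
      1 ≤ (1 + (Real.sqrt 2 - 1) * s) / ((Real.sqrt 2 - 1) - s)) ∧
    (∀ s ∈ Set.Ico (0:ℝ) 1,
      Real.sqrt (2 - (2 * Real.sqrt 2 * s / (1 + s ^ 2)) ^ 2) = Real.sqrt 2 * (1 - s ^ 2) / (1 + s ^ 2)) ∧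
    (∀ s ∈ Set.Ioo (0:ℝ) (Real.sqrt 2 - 1),
      (Real.sqrt 2 * (1 - s ^ 2) / (1 + s ^ 2) + 1) / (Real.sqrt 2 * (1 - s ^ 2) / (1 + s ^ 2) - 1) =
        ((1 - s * (Real.sqrt 2 - 1)) / (s + (Real.sqrt 2 - 1))) *
          ((1 + (Real.sqrt 2 - 1) * s) / ((Real.sqrt 2 - 1) - s))) :=
  ⟨integrableOn_log_moebius₁, integrableOn_log_moebius₂, fun _ hs => one_le_moebius hs,
    fun _ hs => sqrt_two_sub_halfAngle_sq hs, fun _ hs => moebius_factorisation hs⟩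

end Summit.KontsevichZagierPeriods.HurwitzMicroSectors.NormalFormPrinciple.PiBox.M2
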